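import Summits.AnomalousDissipation.AnomalousDissipation.Theses.CoherentStates
import Summits.AnomalousDissipation.AnomalousDissipation.Theses.EulerLimit
import Literature.Analysis.FluidPDE.LongTimeAveragePeriodic

/-!
# Route CoherentStates / EulerLimit (AnomalousDissipation) — `CesaroMeanPeriodic`

Settles the support item stmt-AnomalousDissipation-0514 (`CesaroMeanPeriodic`), wanted by the
routes `CoherentStates` (rank 7) and `EulerLimit` (rank 5) of `AnomalousDissipation`, whose two
route decls have character-identical bodies: for a continuous `τ`-periodic `g : ℝ → ℝ` with
`τ > 0`, the running time means `Literature.Analysis.FluidPDE.timeMean g T = T⁻¹ ∫₀ᵀ g` converge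
to the period mean `τ⁻¹ ∫₀^τ g` as `T → ∞`, and `Literature.Analysis.FluidPDE.longTimeAvgSup g`
(the `limsup` of the running means) equals that period mean.

Both conjuncts are already in the Literature library, with no continuity (indeed no
integrability) hypothesis: `Literature.Analysis.FluidPDE.tendsto_timeMean_atTop_of_periodic` and
`Literature.Analysis.FluidPDE.longTimeAvgSup_eq_of_periodic`
(`Literature/Analysis/FluidPDE/LongTimeAveragePeriodic.lean`; Mathlib's sandwich
`Function.Periodic.sInf_add_zsmul_le_integral_of_pos` / `integral_le_sSup_add_zsmul_of_pos`
divided by `T`). This file only instantiates them at the two route decls; the continuity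
hypothesis of the item is not used. Folklore (Doering–Foias, J. Fluid Mech. 467 (2002) §2).
-/

-- the summit-side namespace `Summit.<Summit>.<Problem>` repeats `AnomalousDissipation` by design (D-0017)
set_option linter.dupNamespace false

namespace Summit.AnomalousDissipation.AnomalousDissipation.Theorems

/-- Settles stmt-AnomalousDissipation-0514 for route `CoherentStates`: Cesàro means of a
continuous `τ`-periodic real function (`τ > 0`) converge to its period mean, and
`longTimeAvgSup` equals that mean. One line from
`Literature.Analysis.FluidPDE.tendsto_timeMean_atTop_of_periodic` /
`longTimeAvgSup_eq_of_periodic` (continuity unused). [folklore] -/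
theorem cesaroMeanPeriodic_proof :
    Summit.AnomalousDissipation.AnomalousDissipation.Theses.CoherentStates.CesaroMeanPeriodic := by
  unfold Summit.AnomalousDissipation.AnomalousDissipation.Theses.CoherentStates.CesaroMeanPeriodic
  intro g τ hτ _hg hper
  exact ⟨Literature.Analysis.FluidPDE.tendsto_timeMean_atTop_of_periodic hper hτ,
    Literature.Analysis.FluidPDE.longTimeAvgSup_eq_of_periodic hper hτ⟩

/-- Settles stmt-AnomalousDissipation-0514 for route `EulerLimit` (same item, character-identical
route decl): Cesàro means of a continuous `τ`-periodic real function (`τ > 0`) converge to its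
period mean, and `longTimeAvgSup` equals that mean. [folklore] -/
theorem cesaroMeanPeriodic_proof_eulerLimit :
    Summit.AnomalousDissipation.AnomalousDissipation.Theses.EulerLimit.CesaroMeanPeriodic := by
  unfold Summit.AnomalousDissipation.AnomalousDissipation.Theses.EulerLimit.CesaroMeanPeriodic
  intro g τ hτ _hg hper
  exact ⟨Literature.Analysis.FluidPDE.tendsto_timeMean_atTop_of_periodic hper hτ,
    Literature.Analysis.FluidPDE.longTimeAvgSup_eq_of_periodic hper hτ⟩

end Summit.AnomalousDissipation.AnomalousDissipation.Theorems
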